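import Summits.PneNP.PneNP.Theses.RootDecompSpaceCeiling
import Literature.Computability.Complexity.PolyHierarchy
import Literature.Computability.Complexity.Oracle
import Literature.Computability.Complexity.OracleEmpty
import Literature.Computability.Complexity.OracleProofs
import Literature.Computability.Complexity.PRelSigmaPi
import Literature.Computability.Complexity.CookReducibilityTransitive

/-! # Root decomposition N3 (SpaceCeiling) — LAW (xii): the BLACK-BOX column of the blocker certificate

Closes the aside item stmt-PneNP-32375 `BlackBoxKCollapse` of route
`route-PneNP-RootDecompSpaceCeiling` (cycle-2 node (b) of the decomp-pnenp cell; writer g6 rev 7;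
critic ruling D24). With `BlackBoxK := ∀ C, NP ⊆ P^C → PP ⊆ P^C` («K proved using the hypothesised
SAT decider only as an oracle, uniformly in the oracle class C»): (1) `BlackBoxK ⟹ PP ⊆ P^NP`
outright (take `C := NP`); (2) `BlackBoxK ⟹ K` (take `C := P`); (3) modulo Toda `PH ⊆ P^PP`
(explicit hypothesis), `BlackBoxK ⟹ PH ⊆ P^NP`.

Port of lens-3 g10 §4 / writer certificate `N3C2_items-g6.lean` (`blackBoxKCollapse_holds`).
Standard axioms only.
-/

namespace Summit.PneNP.PneNP.Theorems

open Literature.Computability.Complexity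

/-- LAW (xii) BLACK-BOX column on `K = CollapseLift` (stmt-PneNP-23703): an oracle-uniform proof of
`K` puts `PP ⊆ P^NP` outright, proves `K`, and (modulo Toda `PH ⊆ P^PP`) collapses `PH` to `P^NP`.
Closes stmt-PneNP-32375. -/
theorem blackBoxKCollapse_proof :
    Summit.PneNP.PneNP.Theses.RootDecompSpaceCeiling.BlackBoxKCollapse := by
  unfold Summit.PneNP.PneNP.Theses.RootDecompSpaceCeiling.BlackBoxKCollapse
    Summit.PneNP.PneNP.Theses.RootDecompSpaceCeiling.CollapseLift
  refine ⟨fun h => h Nondeterministic.NP (self_subset_PRelClass_holds Nondeterministic.NP),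
    fun h => ?_, fun hT h => ?_⟩
  · intro hc L hL
    have hNP : Nondeterministic.NP ⊆ PRelClass Classes.P :=
      fun L' hL' => (self_subset_PRelClass_holds Classes.P) (hc hL')
    exact PRelClass_P_subset_P (h Classes.P hNP hL)
  · have hPP : PP ⊆ PRelClass Nondeterministic.NP :=
      h Nondeterministic.NP (self_subset_PRelClass_holds Nondeterministic.NP)
    have h1 : PRelClass PP ⊆ PRelClass (PRelClass Nondeterministic.NP) := PRelClass_mono hPP
    exact fun L hL => PRelClass_PRelClass_subset_self _ (h1 (hT hL))

end Summit.PneNP.PneNP.Theorems
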